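import Summits.ABC.ABC.Theses.FeketeScales
import Summits.ABC.ABC.Theorems.SparseGoodScales.Negative.ChebyshevForms

/-!
# `SparseGoodScales` (stmt-ABC-2161): located abc triples of quality `3/4` in every window
# (the Chebyshev identity `(u−1)(2u+1)² + 2 = (u+1)(2u−1)²`) — `−1/4 ≤ δ` is load-bearing

Negative / tightness support lemmas for the crux `Summit.ABC.ABC.Theses.FeketeScales.SparseGoodScales`
(line lead c7, line `SketchIdeator4`, registered stub `stub_droughtsOfSomeRatio` "DA∃", and line
`Sketch`'s `stub_windowedGoodScales` "WGS"), continuing `Negative/CubicWindow.lean` (quality `2/3`,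
boundary `−1/3`) one degree up, with the witnesses of `Negative/ChebyshevForms.lean`
(`((6i+5)(12i+13)², 2, (6i+7)(12i+11)²)`, radical EXACTLY `2(6i+5)(6i+7)(12i+11)(12i+13) ≈ 8u⁴`,
`c = (u+1)(2u−1)² ≈ 4u³`, `u = 6i+6`: quality `3/4`):

* `exists_quartic_window` — for every `Λ > 1` and every `M`, every large scale `R` carries such a triple
  with `i ≥ M`, `rad ≤ R < rad^Λ` and `R < 128 u⁴`;
* `chebyshev_c_gt_rpow` / `chebyshev_big` — `X^e < c` for `1 ≤ X < 128 u⁴`, `e < 3/4`, `u` large;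
* `not_droughtsAt_of_lt_neg_quarter` / `not_droughtsOfSomeRatioAt_of_lt_neg_quarter` — **the drought
  matrix (every `Λ > 1`) and statement of `stub_droughtsOfSomeRatio` fail for every `δ < −1/4`**;
* `not_windowedAt_of_lt_neg_quarter` / `not_windowedGoodScalesAt_of_lt_neg_quarter` — **the windowed
  matrix (every `Λ > 1`) and statement of `stub_windowedGoodScales` fail for every `δ < −1/4`**.

So `−1/4 ≤ δ` is load-bearing in both windowed shapes (c6: `−1/2`; `CubicWindow`: `−1/3`).

Scope (honest): nothing about `δ > 0` (the crux).  The quartic totally rational identity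
`(m+1)³(m−3) + 16m = (m−1)³(m+3)` (quality `4/5`) would give `δ < −1/5` the same way (five forms, one
class modulo `9` to sieve at `p = 3`); by Mason–Stothers located families never reach quality `1`, so
`δ → 0⁻` and `windowed_false_at_zero` (Cruxes/SparseGoodScales/Disproof.lean §7) stay abc-strength.
-/

noncomputable section

set_option linter.dupNamespace false

namespace Summit.ABC.ABC.Theorems.SparseGoodScales.Negative

open Literature.NumberTheory.DiophantineGeometry UniqueFactorizationMonoid Finset

/-! ## Every window carries a located quartic radical -/

/-- **Located quartic radicals in every window.**  For every `Λ > 1` and every `M` there is `N` such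
that every scale `R ≥ N` admits `i ≥ M` with the four forms' product (times `2`) squarefree — call it
`r` — and `r ≤ R < r^Λ`, `R < 128 u⁴` where `u = 6i + 6`.  (Let `K` be the largest integer with
`8 (12K+6)⁴ ≤ R`; pick `i ∈ (K, 2K]` by `exists_sqfreeForms4_Ioc`; then `r < 8u⁴ ≤ R < 8(12K+18)⁴ ≤ 128 u⁴`
and `r ≥ 5 u⁴`, so `R < 26 r` and `(R/26)^Λ > R` once `R > 26^{Λ/(Λ−1)}`.) [folklore] -/
theorem exists_quartic_window {Λ : ℝ} (hΛ : 1 < Λ) (M : ℕ) :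
    ∃ N : ℕ, ∀ R : ℕ, N ≤ R → ∃ i : ℕ, M ≤ i ∧
      Squarefree (2 * ((6 * i + 5) * (6 * i + 7) * ((12 * i + 11) * (12 * i + 13)))) ∧
      2 * ((6 * i + 5) * (6 * i + 7) * ((12 * i + 11) * (12 * i + 13))) ≤ R ∧
      (R : ℝ) < 128 * ((6 * i + 6 : ℕ) : ℝ) ^ 4 ∧
      (R : ℝ) < ((2 * ((6 * i + 5) * (6 * i + 7) * ((12 * i + 11) * (12 * i + 13))) : ℕ) : ℝ) ^ Λ := by
  have hΛ1 : 0 < Λ - 1 := by linarith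
  set C : ℝ := (26 : ℝ) ^ (Λ / (Λ - 1)) with hC
  set K₁ : ℕ := max 2000 M with hK₁
  set f : ℕ → ℕ := fun K => 8 * (12 * K + 6) ^ 4 with hf
  refine ⟨max (f (K₁ + 1)) (⌈C⌉₊ + 1), fun R hR => ?_⟩
  have hR1 : f (K₁ + 1) ≤ R := le_trans (le_max_left _ _) hR
  have hR2 : ⌈C⌉₊ + 1 ≤ R := le_trans (le_max_right _ _) hR
  have hfmono : ∀ a b : ℕ, a ≤ b → f a ≤ f b := fun a b hab => by
    simp only [hf]
    exact Nat.mul_le_mul_left _ (Nat.pow_le_pow_left (by omega) 4)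
  have hPK1 : f K₁ ≤ R := le_trans (hfmono _ _ (Nat.le_succ _)) hR1
  have hK1R : K₁ ≤ R := by
    refine le_trans ?_ hPK1
    simp only [hf]
    calc K₁ ≤ 12 * K₁ + 6 := by omega
      _ ≤ (12 * K₁ + 6) ^ 4 := Nat.le_self_pow (by norm_num) _
      _ ≤ 8 * (12 * K₁ + 6) ^ 4 := Nat.le_mul_of_pos_left _ (by norm_num)
  set K := Nat.findGreatest (fun K => f K ≤ R) R with hKdef
  have hK1K : K₁ ≤ K := Nat.le_findGreatest hK1R hPK1
  have hPK : f K ≤ R := Nat.findGreatest_spec (P := fun K => f K ≤ R) hK1R hPK1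
  have hKR : K ≤ R := Nat.findGreatest_le R
  have hnPR : ¬ f R ≤ R := by
    intro h
    have : R < f R := by
      simp only [hf]
      calc R < 12 * R + 6 := by omega
        _ ≤ (12 * R + 6) ^ 4 := Nat.le_self_pow (by norm_num) _
        _ ≤ 8 * (12 * R + 6) ^ 4 := Nat.le_mul_of_pos_left _ (by norm_num)
    exact absurd h (not_le.mpr this)
  have hKlt : K < R := by
    refine lt_of_le_of_ne hKR fun hEq => ?_
    rw [hEq] at hPK
    exact hnPR hPK
  have hnP : ¬ f (K + 1) ≤ R :=
    Nat.findGreatest_is_greatest (P := fun K => f K ≤ R) (Nat.lt_succ_self K) hKlt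
  have hRlt : R < 8 * (12 * K + 18) ^ 4 := by
    have := not_le.mp hnP
    simp only [hf] at this
    rwa [show 12 * (K + 1) + 6 = 12 * K + 18 by ring] at this
  have hK2000 : 2000 ≤ K := le_trans (le_max_left _ _) hK1K
  have hKM : M ≤ K := le_trans (le_max_right _ _) hK1K
  obtain ⟨i, hKi, hi2K, hs1, hs2, hs3, hs4⟩ := exists_sqfreeForms4_Ioc hK2000
  have hsq := squarefree_chebyshev_forms hs1 hs2 hs3 hs4
  set u : ℕ := 6 * i + 6 with hu
  set r : ℕ := 2 * ((6 * i + 5) * (6 * i + 7) * ((12 * i + 11) * (12 * i + 13))) with hr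
  have hulo : 12 * K + 18 ≤ 2 * u := by omega
  have huhi : u ≤ 12 * K + 6 := by omega
  -- `r < 8 u⁴` and `r ≥ 5 u⁴` (as reals)
  have hru : (r : ℝ) = 2 * (((u : ℝ) - 1) * ((u : ℝ) + 1) * ((2 * (u : ℝ) - 1) * (2 * (u : ℝ) + 1))) := by
    rw [hr, hu]
    push_cast
    ring
  have hu12 : (12 : ℝ) ≤ u := by
    have : 12 ≤ u := by omega
    exact_mod_cast this
  have hr_lt : (r : ℝ) < 8 * (u : ℝ) ^ 4 := by
    rw [hru]; nlinarith [sq_nonneg (u : ℝ), mul_pos (by linarith : (0 : ℝ) < u) (by linarith : (0 : ℝ) < u)]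
  have hr_ge : 5 * (u : ℝ) ^ 4 ≤ r := by
    rw [hru]
    have hu2 : (144 : ℝ) ≤ (u : ℝ) ^ 2 := by nlinarith
    nlinarith [sq_nonneg (u : ℝ), sq_nonneg ((u : ℝ) ^ 2)]
  refine ⟨i, by omega, hsq, ?_, ?_, ?_⟩
  · -- `r < 8 u⁴ ≤ 8 (12K+6)⁴ = f K ≤ R`
    have h1 : (r : ℝ) < ((8 * (12 * K + 6) ^ 4 : ℕ) : ℝ) := by
      have h2 : ((u : ℕ) : ℝ) ≤ ((12 * K + 6 : ℕ) : ℝ) := by exact_mod_cast huhi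
      have h3 : (u : ℝ) ^ 4 ≤ (((12 * K + 6 : ℕ) : ℝ)) ^ 4 :=
        pow_le_pow_left₀ (by positivity) h2 4
      push_cast at h3 ⊢
      linarith
    have h2 : r < 8 * (12 * K + 6) ^ 4 := by exact_mod_cast h1
    have h3 : 8 * (12 * K + 6) ^ 4 ≤ R := by simpa [hf] using hPK
    omega
  · -- `R < 8 (12K+18)⁴ ≤ 8 (2u)⁴ = 128 u⁴`
    have h1 : ((R : ℕ) : ℝ) < ((8 * (12 * K + 18) ^ 4 : ℕ) : ℝ) := by exact_mod_cast hRlt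
    have h2 : ((12 * K + 18 : ℕ) : ℝ) ≤ ((2 * u : ℕ) : ℝ) := by exact_mod_cast hulo
    have h3 : (((12 * K + 18 : ℕ) : ℝ)) ^ 4 ≤ (((2 * u : ℕ) : ℝ)) ^ 4 :=
      pow_le_pow_left₀ (by positivity) h2 4
    have h4 : (((2 * u : ℕ) : ℝ)) ^ 4 = 16 * (u : ℝ) ^ 4 := by push_cast; ring
    have h5 : ((8 * (12 * K + 18) ^ 4 : ℕ) : ℝ) = 8 * (((12 * K + 18 : ℕ) : ℝ)) ^ 4 := by
      push_cast; ring
    rw [h4] at h3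
    rw [h5] at h1
    linarith
  · -- `R < 128 u⁴ ≤ 26 r` and `R > 26^{Λ/(Λ−1)}` give `R < r^Λ`
    have hlow : (R : ℝ) < 26 * (r : ℝ) := by
      have h1 : ((R : ℕ) : ℝ) < ((8 * (12 * K + 18) ^ 4 : ℕ) : ℝ) := by exact_mod_cast hRlt
      have h2 : ((12 * K + 18 : ℕ) : ℝ) ≤ ((2 * u : ℕ) : ℝ) := by exact_mod_cast hulo
      have h3 : (((12 * K + 18 : ℕ) : ℝ)) ^ 4 ≤ (((2 * u : ℕ) : ℝ)) ^ 4 :=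
        pow_le_pow_left₀ (by positivity) h2 4
      push_cast at h1 h3
      nlinarith [h1, h3, hr_ge]
    have hRpos : (0 : ℝ) < R := by
      have h' : 0 < f (K₁ + 1) := by simp only [hf]; positivity
      exact_mod_cast lt_of_lt_of_le h' hR1
    have hRM : C < R := by
      have h1 : C ≤ ⌈C⌉₊ := Nat.le_ceil C
      have h2 : ((⌈C⌉₊ + 1 : ℕ) : ℝ) ≤ R := by exact_mod_cast hR2
      push_cast at h2
      linarith
    have hC0 : (0 : ℝ) < 26 := by norm_num
    have hM0 : 0 ≤ C := Real.rpow_nonneg hC0.le _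
    have hkey : (26 : ℝ) ^ Λ < (R : ℝ) ^ (Λ - 1) := by
      have h := Real.rpow_lt_rpow hM0 hRM hΛ1
      rwa [hC, ← Real.rpow_mul hC0.le, div_mul_cancel₀ _ hΛ1.ne'] at h
    have hRΛ : (R : ℝ) * (26 : ℝ) ^ Λ < (R : ℝ) ^ Λ := by
      have h1 : (R : ℝ) ^ Λ = (R : ℝ) ^ (Λ - 1) * R := by
        rw [← Real.rpow_add_one hRpos.ne' (Λ - 1)]
        ring_nf
      rw [h1, mul_comm ((R : ℝ) ^ (Λ - 1))]
      exact mul_lt_mul_of_pos_left hkey hRpos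
    have hCΛ : (0 : ℝ) < (26 : ℝ) ^ Λ := Real.rpow_pos_of_pos hC0 Λ
    have hdiv : (R : ℝ) < ((R : ℝ) / 26) ^ Λ := by
      rw [Real.div_rpow hRpos.le hC0.le, lt_div_iff₀ hCΛ]
      exact hRΛ
    have hrad : (R : ℝ) / 26 < (r : ℝ) := by
      rw [div_lt_iff₀ hC0]
      linarith
    calc (R : ℝ) < ((R : ℝ) / 26) ^ Λ := hdiv
      _ < (r : ℝ) ^ Λ := Real.rpow_lt_rpow (by positivity) hrad (by linarith)

/-! ## Consequences: `−1/4 ≤ δ` is load-bearing in the drought stub and in the windowed stub -/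

/-- Key inequality for the Chebyshev witness: if `1 ≤ X < 128 u⁴`, `u ≥ 12`, `e < 3/4` and either
`e ≤ 0` or `u^{3 − 4e} > 128`, then `X^e < (u+1)(2u−1)² = c` (`c = 4u³ − 3u + 1 ≥ 3u³`).  Used with
`X = rad` (drought) and `X = R` (windowed). [folklore] -/
theorem chebyshev_c_gt_rpow {u : ℕ} (hu : 12 ≤ u) {e : ℝ} (he : e < 3 / 4) {X : ℝ} (hX1 : 1 ≤ X)
    (hX : X < 128 * (u : ℝ) ^ 4) (hbig : e ≤ 0 ∨ (128 : ℝ) < (u : ℝ) ^ (3 - 4 * e)) :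
    X ^ e < ((u : ℝ) + 1) * (2 * (u : ℝ) - 1) ^ 2 := by
  have hu' : (12 : ℝ) ≤ u := by exact_mod_cast hu
  have hu0 : (0 : ℝ) < u := by linarith
  have hcexp : ((u : ℝ) + 1) * (2 * (u : ℝ) - 1) ^ 2 = 4 * (u : ℝ) ^ 3 - 3 * u + 1 := by ring
  have hu3 : (0 : ℝ) ≤ (u : ℝ) ^ 3 - 3 * u := by
    nlinarith [mul_nonneg (mul_nonneg hu0.le hu0.le) (by linarith : (0 : ℝ) ≤ u - 2)]
  have hc3 : 3 * (u : ℝ) ^ 3 ≤ ((u : ℝ) + 1) * (2 * (u : ℝ) - 1) ^ 2 := by rw [hcexp]; linarith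
  have hu3pos : (0 : ℝ) < (u : ℝ) ^ 3 := pow_pos hu0 3
  by_cases he0 : e ≤ 0
  · have h1 : X ^ e ≤ 1 := Real.rpow_le_one_of_one_le_of_nonpos hX1 he0
    nlinarith
  · push Not at he0
    have hbig' : (128 : ℝ) < (u : ℝ) ^ (3 - 4 * e) := hbig.resolve_left (not_le.mpr he0)
    have hX0 : 0 ≤ X := by linarith
    have step1 : X ^ e < (128 * (u : ℝ) ^ 4) ^ e := Real.rpow_lt_rpow hX0 hX he0
    have step2 : (128 * (u : ℝ) ^ 4) ^ e = (128 : ℝ) ^ e * (u : ℝ) ^ (4 * e) := by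
      rw [Real.mul_rpow (by norm_num) (by positivity), ← Real.rpow_natCast,
        ← Real.rpow_mul hu0.le]
      norm_num
    have step3 : (128 : ℝ) ^ e ≤ 128 := by
      have : (128 : ℝ) ^ e ≤ (128 : ℝ) ^ (1 : ℝ) :=
        Real.rpow_le_rpow_of_exponent_le (by norm_num) (by linarith)
      rwa [Real.rpow_one] at this
    have step4 : (u : ℝ) ^ (3 - 4 * e) * (u : ℝ) ^ (4 * e) = (u : ℝ) ^ (3 : ℕ) := by
      rw [← Real.rpow_add hu0, show 3 - 4 * e + 4 * e = ((3 : ℕ) : ℝ) by push_cast; ring,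
        Real.rpow_natCast]
    have hpos4 : (0 : ℝ) < (u : ℝ) ^ (4 * e) := Real.rpow_pos_of_pos hu0 _
    have step5 : (128 : ℝ) * (u : ℝ) ^ (4 * e) < (u : ℝ) ^ (3 - 4 * e) * (u : ℝ) ^ (4 * e) :=
      mul_lt_mul_of_pos_right hbig' hpos4
    rw [step4] at step5
    have step6 : (128 : ℝ) ^ e * (u : ℝ) ^ (4 * e) ≤ 128 * (u : ℝ) ^ (4 * e) :=
      mul_le_mul_of_nonneg_right step3 hpos4.le
    rw [step2] at step1
    linarith

/-- The size threshold: for `0 < e < 3/4` and `i > 128^{1/(3−4e)}`, `u = 6i+6` has `u^{3−4e} > 128`.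
[folklore] -/
theorem chebyshev_big {e : ℝ} (he : e < 3 / 4) {i : ℕ}
    (hi : ⌈(128 : ℝ) ^ (1 / (3 - 4 * e))⌉₊ + 1 ≤ i) :
    (128 : ℝ) < (((6 * i + 6 : ℕ)) : ℝ) ^ (3 - 4 * e) := by
  have h34 : 0 < 3 - 4 * e := by linarith
  set B : ℝ := (128 : ℝ) ^ (1 / (3 - 4 * e)) with hB
  have hB0 : 0 ≤ B := Real.rpow_nonneg (by norm_num) _
  have hBi : B < ((6 * i + 6 : ℕ) : ℝ) := by
    have h1 : B ≤ ⌈B⌉₊ := Nat.le_ceil B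
    have h2 : ((⌈B⌉₊ + 1 : ℕ) : ℝ) ≤ i := by exact_mod_cast hi
    have h3 : ((i : ℕ) : ℝ) ≤ ((6 * i + 6 : ℕ) : ℝ) := by exact_mod_cast (by omega : i ≤ 6 * i + 6)
    push_cast at h2 h3 ⊢
    linarith
  have h := Real.rpow_lt_rpow hB0 hBi h34
  rwa [hB, ← Real.rpow_mul (by norm_num : (0 : ℝ) ≤ 128), one_div_mul_cancel h34.ne',
    Real.rpow_one] at h

/-- **The drought matrix fails for every `δ < −1/4` and every `Λ > 1`.**  (Body of
`stub_droughtsOfSomeRatio` with `δ`, `Λ` free.)  The Chebyshev witness of `exists_quartic_window` sits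
in the window and has `c = (u+1)(2u−1)² > rad^{1+δ}` (`rad ≤ R < 128 u⁴`, quality `3/4`).  Sharpens
`not_droughtsAt_of_le_neg_third`. [folklore] -/
theorem not_droughtsAt_of_lt_neg_quarter {δ : ℝ} (hδ : δ < -1 / 4) {Λ : ℝ} (hΛ : 1 < Λ) :
    ¬ ∀ N : ℕ, ∃ R : ℕ, N ≤ R ∧ ∀ a b c : ℕ, IsABCTriple a b c → rad a b c ≤ R →
      (R : ℝ) < ((rad a b c : ℕ) : ℝ) ^ Λ → (c : ℝ) ≤ ((rad a b c : ℕ) : ℝ) ^ (1 + δ) := by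
  intro h
  have he : 1 + δ < 3 / 4 := by linarith
  obtain ⟨N, hN⟩ := exists_quartic_window hΛ (⌈(128 : ℝ) ^ (1 / (3 - 4 * (1 + δ)))⌉₊ + 1)
  obtain ⟨R, hNR, hR⟩ := h N
  obtain ⟨i, hMi, hsq, hle, h128, hlt⟩ := hN R hNR
  have ht := isABCTriple_chebyshev i
  have hrad := rad_chebyshev hsq
  have hc := hR _ _ _ ht (by rw [hrad]; exact hle) (by rw [hrad]; exact hlt)
  rw [hrad] at hc
  set r : ℕ := 2 * ((6 * i + 5) * (6 * i + 7) * ((12 * i + 11) * (12 * i + 13))) with hr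
  have hr1 : (1 : ℝ) ≤ (r : ℝ) := by
    have : 1 ≤ r := Nat.one_le_iff_ne_zero.mpr hsq.ne_zero
    exact_mod_cast this
  have hrR : (r : ℝ) ≤ R := by exact_mod_cast hle
  have hkey := chebyshev_c_gt_rpow (u := 6 * i + 6) (by omega) he hr1 (by linarith)
    (Or.inr (chebyshev_big he hMi))
  have hcc : (((6 * i + 7) * (12 * i + 11) ^ 2 : ℕ) : ℝ) =
      ((((6 * i + 6 : ℕ)) : ℝ) + 1) * (2 * (((6 * i + 6 : ℕ)) : ℝ) - 1) ^ 2 := by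
    push_cast; ring
  rw [hcc] at hc
  linarith

/-- **The drought STATEMENT fails for every `δ < −1/4`** (`stub_droughtsOfSomeRatio` with `0 < δ`
replaced by `δ < −1/4` is false; `−1/4 ≤ δ` is load-bearing). [folklore] -/
theorem not_droughtsOfSomeRatioAt_of_lt_neg_quarter {δ : ℝ} (hδ : δ < -1 / 4) :
    ¬ ∃ Λ : ℝ, 1 < Λ ∧ ∀ N : ℕ, ∃ R : ℕ, N ≤ R ∧ ∀ a b c : ℕ,
      IsABCTriple a b c → rad a b c ≤ R → (R : ℝ) < ((rad a b c : ℕ) : ℝ) ^ Λ →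
        (c : ℝ) ≤ ((rad a b c : ℕ) : ℝ) ^ (1 + δ) := by
  rintro ⟨Λ, hΛ, hmat⟩
  exact not_droughtsAt_of_lt_neg_quarter hδ hΛ hmat

/-- **The windowed matrix fails for every `δ < −1/4` and every `Λ > 1`.**  (Body of line `Sketch`'s
`stub_windowedGoodScales` with `δ`, `Λ` free: `… → c ≤ R^{1+δ}`.)  For the Chebyshev witness
`R < 128 u⁴`, so `R^{1+δ} < c` exactly as for the radical.  Sharpens `not_windowedAt_of_lt_neg_third`.
[folklore] -/
theorem not_windowedAt_of_lt_neg_quarter {δ : ℝ} (hδ : δ < -1 / 4) {Λ : ℝ} (hΛ : 1 < Λ) :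
    ¬ ∀ N : ℕ, ∃ R : ℕ, N ≤ R ∧ ∀ a b c : ℕ, IsABCTriple a b c → rad a b c ≤ R →
      (R : ℝ) < ((rad a b c : ℕ) : ℝ) ^ Λ → (c : ℝ) ≤ (R : ℝ) ^ (1 + δ) := by
  intro h
  have he : 1 + δ < 3 / 4 := by linarith
  obtain ⟨N, hN⟩ := exists_quartic_window hΛ (⌈(128 : ℝ) ^ (1 / (3 - 4 * (1 + δ)))⌉₊ + 1)
  obtain ⟨R, hNR, hR⟩ := h (max N 1)
  obtain ⟨i, hMi, hsq, hle, h128, hlt⟩ := hN R (le_trans (le_max_left _ _) hNR)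
  have ht := isABCTriple_chebyshev i
  have hrad := rad_chebyshev hsq
  have hc := hR _ _ _ ht (by rw [hrad]; exact hle) (by rw [hrad]; exact hlt)
  have hR1 : (1 : ℝ) ≤ R := by exact_mod_cast le_trans (le_max_right N 1) hNR
  have hkey := chebyshev_c_gt_rpow (u := 6 * i + 6) (by omega) he hR1 h128
    (Or.inr (chebyshev_big he hMi))
  have hcc : (((6 * i + 7) * (12 * i + 11) ^ 2 : ℕ) : ℝ) =
      ((((6 * i + 6 : ℕ)) : ℝ) + 1) * (2 * (((6 * i + 6 : ℕ)) : ℝ) - 1) ^ 2 := by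
    push_cast; ring
  rw [hcc] at hc
  linarith

/-- **The windowed STATEMENT fails for every `δ < −1/4`** (line `Sketch`'s `stub_windowedGoodScales`
with `δ` free; `−1/4 ≤ δ` is load-bearing). [folklore] -/
theorem not_windowedGoodScalesAt_of_lt_neg_quarter {δ : ℝ} (hδ : δ < -1 / 4) :
    ¬ ∀ Λ : ℝ, 1 < Λ → ∀ N : ℕ, ∃ R : ℕ, N ≤ R ∧ ∀ a b c : ℕ, IsABCTriple a b c →
      rad a b c ≤ R → (R : ℝ) < ((rad a b c : ℕ) : ℝ) ^ Λ → (c : ℝ) ≤ (R : ℝ) ^ (1 + δ) :=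
  fun h => not_windowedAt_of_lt_neg_quarter hδ (Λ := 2) (by norm_num) (h 2 (by norm_num))

end Summit.ABC.ABC.Theorems.SparseGoodScales.Negative
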